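import Literature.Computability.QuantumComplexity.ReadoutSelfDuality
import Literature.Computability.QuantumComplexity.LowWeightPauliPropagation
import Literature.LinearAlgebra.Matrix.NormalMatrixSpectralTheorem
import HarnessLib

/-!
# Singer read-out isotropy: eigenbases of Pauli-regular unitaries are isotropic clean read-outs; the bound `m ≤ 2ⁿ + 1`; a two-qubit inhabitant

THE OBJECT. A unitary `V` on the register `ι → Bool` is **Pauli-regular of period `m`** (`IsPauliRegular`) when every power `V^k`, `0 < k < m`,
moves every string `P ≠ Iⁿ` to an ORTHOGONAL one (`Tr((V^k)† σ_P V^k σ_P) = 0`) and `V^m = c·1`; for `m = 2ⁿ + 1`: the Singer-cycle Cliffords.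

THE LAW (`r = 0`, one clean read-out layer, the tree's transmissivity `sectorTrans` of L-26/L-67 transported along `sectorTrans_head` BY NAME). (S0)
ONE-LAYER DIAGONAL FORM `π_U(P) = 2⁻ⁿ Σ_x |(U σ_P U†)_{xx}|²` for every unitary layer. (S1) SCHUR FOR THE PAULI GROUP: a register matrix commuting
with every Pauli string is scalar (so a Pauli action that returns with trivial phases after `m` steps makes `V^m` central). (S2) PINCHING CEILING: if
`U` diagonalises a Pauli-regular `V` of period `m` (`U V U† = diag λ`; existence of such a unitary is the tree's spectral theorem
`Literature.LinearAlgebra.Matrix.isStarNormal_iff_exists_unitaryGroup_conj_eq_diagonal` BY NAME — its ONLY use-site is `exists_isotropic_of_pauliRegular`;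
no eigenvector is written, simplicity of the spectrum never used) then `π_U(P) ≤ 1/m` for every moved `P` — engine: `Σ_{k<m} Tr((V^k)† σ_P V^k σ_P)`
is `2ⁿ` by orthogonality and `= Σ_{x,y} |B_{xy}|² Σ_{k<m} (λ̄_x λ_y)^k ≥ m Σ_x |B_{xx}|²` in the eigenbasis (`B = U σ_P U†`, roots of unity). (S3)
SINGER BOUND: with L-67's sum rule `sum_sectorTrans` BY NAME, `m (2ⁿ − 1) ≤ 4ⁿ − 1`, i.e. `m ≤ 2ⁿ + 1`. (S4) ISOTROPY AT EQUALITY: `m = 2ⁿ + 1 ⇒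
π_U(P) = 1/(2ⁿ+1)` for every `P ≠ Iⁿ` — the profile L-110 (`ReadoutSelfDuality`, C4) showed law-consistent and left OPEN for `n ≥ 2`.

THE NEGATION + INHABITANT (`n = 2`). `V₅ := CZ · (K ⊗ H′)` (`K` = the tree's axis-cycler `LocalScrambling.cycMat`, `H′ = (1+i)(σ_X + σ_Z)/2`) is
Pauli-regular of period `5 = 2² + 1` (one-step conjugation table typed over `ℂ` by `ext/cases/simp`; exactly THREE finite orbit facts on `Pauli × Pauli`
— `g2_iterate_five`, `g2_iterate_ne`, `neg2_cycle` — by kernel `decide`), so an ISOTROPIC clean unitary read-out EXISTS on two qubits, and the one-member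
family behind it is UNIFORM with `β = 1/5 ∉ {0,1}`, `|J| = 1 < 5`: L-90 U5 `floor_of_zero_one` minus `h01` fails at `n = 2` with the maximal deficit.

Sources: transmissivity currency [cite: AharonovEtAl2023, Definition 5 and Lemma 4], [cite: FeffermanEtAl2023, §10 Remarks 20–22]; Pauli bookkeeping
[cite: KempeEtAl2010, §2]; MUBs as eigenbases of commuting classes / the count `2ⁿ + 1` [cite: BandyopadhyayEtAl2002, Lemma 3.1 and Theorem 3.2],
[cite: KlappeneckerRoetteler2005, §1 and Theorem 4], [cite: WoottersFields1989]; pinching [cite: NielsenChuang2010, §11.3.3 Theorem 11.9]. HONEST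
SCOPE: exact finite-dimensional identities about `r = 0` one-layer clean unitary read-outs and one explicit `4 × 4` Clifford; existence for `n ≥ 3` is
conditional on a period-`(2ⁿ+1)` Pauli-regular unitary (Singer-cycle Cliffords, in print — not typed here); nothing about `r > 0`, samplers, spoofers,
tests or hardness. Nothing here bears on BQP vs BPP.
-/

open Matrix Finset

namespace Literature.Computability.QuantumComplexity.PauliPath.DampingCleanSuffix.MemberCollision.UniformReadout.SelfDual.Singer
open Literature.Computability.QuantumComplexity.PauliPath.DampingCleanSuffix.MemberCollision.Spreading

variable {ι : Type} [Fintype ι] [DecidableEq ι]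

/-- `U U† = 1` for a unitary-group member. [folklore] -/
private theorem mul_ct_of_mem {n : Type} [Fintype n] [DecidableEq n] {U : Matrix n n ℂ} (hU : U ∈ Matrix.unitaryGroup n ℂ) :
    U * Uᴴ = 1 := by have h := Matrix.mem_unitaryGroup_iff.mp hU; rwa [Matrix.star_eq_conjTranspose] at h

/-- `U† U = 1` for a unitary-group member. [folklore] -/
private theorem ct_mul_of_mem {n : Type} [Fintype n] [DecidableEq n] {U : Matrix n n ℂ} (hU : U ∈ Matrix.unitaryGroup n ℂ) :
    Uᴴ * U = 1 := by have h := Matrix.mem_unitaryGroup_iff'.mp hU; rwa [Matrix.star_eq_conjTranspose] at h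

/-! ## §1 Schur for the Pauli group: the commutant of the Pauli strings is the scalars -/

/-- **SCHUR FOR THE PAULI GROUP (entrywise).** A register matrix commuting with every Pauli string has all diagonal entries equal and all off-diagonal
entries zero (Pauli completeness `Σ_S σ_S ⊗ σ_S = 2ⁿ·SWAP`). [cite: KempeEtAl2010, §2 (𝒫ⁿ is an orthogonal basis of the 2ⁿ × 2ⁿ matrices)] -/
theorem apply_eq_of_forall_comm {M : Matrix (ι → Bool) (ι → Bool) ℂ}
    (hM : ∀ S : ι → Pauli, pauliString S * M = M * pauliString S) (a x y : ι → Bool) :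
    M x y = if x = y then M a a else 0 := by
  have h2 : ((2 : ℂ) ^ Fintype.card ι) ≠ 0 := pow_ne_zero _ two_ne_zero
  -- the `(a, y)` entry of `σ_S M = M σ_S`, multiplied by `(σ_S)_{x a}` and summed over `S`
  have hS : ∀ S : ι → Pauli, (∑ c, pauliString S a c * M c y) * pauliString S x a =
      (∑ c, M a c * pauliString S c y) * pauliString S x a := fun S => by
    have h := congrFun (congrFun (hM S) a) y; simp only [Matrix.mul_apply] at h; rw [h]
  have hsum := Fintype.sum_congr _ _ hS
  have hl : ∑ S : ι → Pauli, (∑ c, pauliString S a c * M c y) * pauliString S x a =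
      (2 : ℂ) ^ Fintype.card ι * M x y := by
    calc ∑ S : ι → Pauli, (∑ c, pauliString S a c * M c y) * pauliString S x a
        = ∑ c, M c y * ∑ S : ι → Pauli, pauliString S a c * pauliString S x a := by
          simp only [Finset.sum_mul, Finset.mul_sum]
          rw [Finset.sum_comm]
          exact Finset.sum_congr rfl fun c _ => Finset.sum_congr rfl fun S _ => by ring
      _ = (2 : ℂ) ^ Fintype.card ι * M x y := by
          simp only [sum_pauliString_apply_mul_apply, true_and, mul_ite, mul_zero]
          rw [Finset.sum_ite_eq' Finset.univ x, if_pos (Finset.mem_univ x), mul_comm]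
  have hr : ∑ S : ι → Pauli, (∑ c, M a c * pauliString S c y) * pauliString S x a =
      if x = y then (2 : ℂ) ^ Fintype.card ι * M a a else 0 := by
    calc ∑ S : ι → Pauli, (∑ c, M a c * pauliString S c y) * pauliString S x a
        = ∑ c, M a c * ∑ S : ι → Pauli, pauliString S c y * pauliString S x a := by
          simp only [Finset.sum_mul, Finset.mul_sum]
          rw [Finset.sum_comm]
          exact Finset.sum_congr rfl fun c _ => Finset.sum_congr rfl fun S _ => by ring
      _ = if x = y then (2 : ℂ) ^ Fintype.card ι * M a a else 0 := by
          simp only [sum_pauliString_apply_mul_apply, mul_ite, mul_zero]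
          by_cases hxy : x = y
          · subst hxy; simp only [and_true, if_true]
            rw [Finset.sum_ite_eq' Finset.univ a, if_pos (Finset.mem_univ a), mul_comm]
          · rw [if_neg hxy]
            exact Finset.sum_eq_zero fun c _ => by rw [if_neg (fun h => hxy h.2.symm)]
  rw [hl, hr] at hsum
  by_cases hxy : x = y
  · rw [if_pos hxy] at hsum ⊢; exact mul_left_cancel₀ h2 hsum
  · rw [if_neg hxy] at hsum ⊢; exact (mul_eq_zero.mp hsum).resolve_left h2

/-- **SCHUR FOR THE PAULI GROUP.** A register matrix commuting with every Pauli string is a scalar. [cite: KempeEtAl2010, §2 (𝒫ⁿ is an orthogonal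
basis)] -/
theorem eq_smul_one_of_forall_comm {M : Matrix (ι → Bool) (ι → Bool) ℂ}
    (hM : ∀ S : ι → Pauli, pauliString S * M = M * pauliString S) :
    M = M (fun _ => false) (fun _ => false) • (1 : Matrix (ι → Bool) (ι → Bool) ℂ) := by
  ext x y
  rw [apply_eq_of_forall_comm hM (fun _ => false) x y, Matrix.smul_apply, Matrix.one_apply, smul_eq_mul,
    mul_ite, mul_one, mul_zero]

/-! ## §2 Pauli actions: conjugation tables iterate, and moved strings are orthogonal -/

/-- **ITERATED CONJUGATION TABLE.** If `V† σ_a V = φ(a)·σ_{g a}` for every string, then `(V^k)† σ_a V^k = (∏_{j<k} φ(g^j a))·σ_{g^k a}`. [cite: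
KempeEtAl2010, §2 Observation 4 (conjugation by Clifford layers permutes 𝒫ⁿ up to phase)] -/
theorem conj_pow_of_table {V : Matrix (ι → Bool) (ι → Bool) ℂ} {g : (ι → Pauli) → ι → Pauli}
    {φ : (ι → Pauli) → ℂ} (htab : ∀ a, Vᴴ * pauliString a * V = φ a • pauliString (g a)) (k : ℕ)
    (a : ι → Pauli) :
    (V ^ k)ᴴ * pauliString a * V ^ k = (∏ j ∈ Finset.range k, φ (g^[j] a)) • pauliString (g^[k] a) := by
  induction k with
  | zero => simp
  | succ k ih =>
    rw [pow_succ, Matrix.conjTranspose_mul, Finset.prod_range_succ, Function.iterate_succ_apply']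
    calc Vᴴ * (V ^ k)ᴴ * pauliString a * (V ^ k * V)
        = Vᴴ * ((V ^ k)ᴴ * pauliString a * V ^ k) * V := by simp only [Matrix.mul_assoc]
      _ = (∏ j ∈ Finset.range k, φ (g^[j] a)) • (Vᴴ * pauliString (g^[k] a) * V) := by
          rw [ih, Matrix.mul_smul, Matrix.smul_mul]
      _ = ((∏ j ∈ Finset.range k, φ (g^[j] a)) * φ (g^[k] a)) • pauliString (g (g^[k] a)) := by
          rw [htab, smul_smul]

/-- **MOVED STRINGS ARE ORTHOGONAL.** Under a conjugation table, `Tr((V^k)† σ_a V^k σ_a) = 0` as soon as `g^k a ≠ a`. [cite: KempeEtAl2010, §2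
(Tr(SS') = 0 for S ≠ S')] -/
theorem trace_conj_pow_eq_zero {V : Matrix (ι → Bool) (ι → Bool) ℂ} {g : (ι → Pauli) → ι → Pauli}
    {φ : (ι → Pauli) → ℂ} (htab : ∀ a, Vᴴ * pauliString a * V = φ a • pauliString (g a)) {k : ℕ}
    {a : ι → Pauli} (hmove : g^[k] a ≠ a) :
    ((V ^ k)ᴴ * pauliString a * V ^ k * pauliString a).trace = 0 := by
  rw [conj_pow_of_table htab, Matrix.smul_mul, Matrix.trace_smul, trace_pauliString_mul_pauliString,
    if_neg hmove, smul_zero]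

/-- **PERIOD ⇒ CENTRAL.** If the table returns after `m` steps with trivial accumulated phase (`g^m = id`, `∏_{j<m} φ(g^j a) = 1`) and `V V† = 1`,
then `V^m` commutes with every Pauli string, hence is a scalar. [cite: KempeEtAl2010, §2 Observation 4] -/
theorem pow_eq_smul_one_of_table {V : Matrix (ι → Bool) (ι → Bool) ℂ} {g : (ι → Pauli) → ι → Pauli}
    {φ : (ι → Pauli) → ℂ} (htab : ∀ a, Vᴴ * pauliString a * V = φ a • pauliString (g a))
    (hV : V ∈ Matrix.unitaryGroup (ι → Bool) ℂ) {m : ℕ} (hret : ∀ a, g^[m] a = a)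
    (hphase : ∀ a, ∏ j ∈ Finset.range m, φ (g^[j] a) = 1) :
    V ^ m = (V ^ m) (fun _ => false) (fun _ => false) • (1 : Matrix (ι → Bool) (ι → Bool) ℂ) := by
  have hVm : V ^ m * (V ^ m)ᴴ = 1 := mul_ct_of_mem (pow_mem hV m)
  refine eq_smul_one_of_forall_comm fun S => ?_
  have hk := conj_pow_of_table htab m S
  rw [hret, hphase, one_smul] at hk
  calc pauliString S * V ^ m = V ^ m * (V ^ m)ᴴ * pauliString S * V ^ m := by rw [hVm, Matrix.one_mul]
    _ = V ^ m * ((V ^ m)ᴴ * pauliString S * V ^ m) := by simp only [Matrix.mul_assoc]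
    _ = V ^ m * pauliString S := by rw [hk]

/-! ## §3 The one-layer diagonal form of the read-out transmissivity -/

/-- The Z-type strings are exactly the phase strings `Z^z`, `z : ι → Bool`. [cite: NielsenChuang2010, §11.3.3 proof of Theorem 11.9] -/
theorem filter_ZType_eq_image_zString :
    (Finset.univ.filter fun Q : ι → Pauli => ∀ i, Q i = Pauli.I ∨ Q i = Pauli.Z) =
      Finset.univ.image (EntropyCeiling.zString (ι := ι)) := by
  ext Q
  simp only [Finset.mem_filter, Finset.mem_univ, true_and, Finset.mem_image]
  unfold EntropyCeiling.zString
  constructor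
  · exact fun hQ => ⟨fun i => decide (Q i = Pauli.Z), funext fun i => by rcases hQ i with h | h <;> simp [h]⟩
  · rintro ⟨z, rfl⟩ i
    cases z i <;> simp

omit [Fintype ι] [DecidableEq ι] in
/-- `zString` is injective. [folklore] -/
private theorem zString_injective : Function.Injective (EntropyCeiling.zString (ι := ι)) := by
  refine fun z w h => funext fun i => ?_
  have hi := congrFun h i
  revert hi; unfold EntropyCeiling.zString; cases z i <;> cases w i <;> simp

omit [DecidableEq ι] in
/-- The characters are real: `conj χ_z(x) = χ_z(x)`. [folklore] -/
private theorem star_zSign (z x : ι → Bool) : star (EntropyCeiling.zSign z x) = EntropyCeiling.zSign z x := by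
  unfold EntropyCeiling.zSign
  rw [star_prod]
  exact Finset.prod_congr rfl fun i _ => by split_ifs <;> simp

/-- The Pauli coefficient of a phase string reads the diagonal: `Tr(Z^z B) = Σ_x χ_z(x) B_{xx}`. [cite: NielsenChuang2010, §11.3.3 proof of Theorem
11.9 (pinching via the Z-strings)] -/
theorem pauliCoeff_zString (B : Matrix (ι → Bool) (ι → Bool) ℂ) (z : ι → Bool) :
    pauliCoeff B (EntropyCeiling.zString z) = ∑ x, EntropyCeiling.zSign z x * B x x := by
  rw [pauliCoeff_eq, EntropyCeiling.pauliString_zString, Matrix.trace]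
  simp only [Matrix.diag_apply, Matrix.diagonal_mul]

/-- **PARSEVAL OVER THE LAGRANGIAN `{I,Z}ⁿ`.** `Σ_{Q ∈ {I,Z}ⁿ} |Tr(σ_Q B)|² = 2ⁿ Σ_x |B_{xx}|²` — the Z-type Pauli coefficients see exactly the
diagonal (orthogonality of the characters `sum_zSign_mul_zSign` BY NAME). [cite: NielsenChuang2010, §11.3.3 Theorem 11.9 (pinching); KempeEtAl2010, §2
(Parseval)] -/
theorem sum_ZType_norm_pauliCoeff_sq (B : Matrix (ι → Bool) (ι → Bool) ℂ) :
    ∑ Q ∈ Finset.univ.filter (fun Q : ι → Pauli => ∀ i, Q i = Pauli.I ∨ Q i = Pauli.Z), ‖pauliCoeff B Q‖ ^ 2 =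
      (2 : ℝ) ^ Fintype.card ι * ∑ x, ‖B x x‖ ^ 2 := by
  rw [filter_ZType_eq_image_zString, Finset.sum_image fun z _ w _ h => zString_injective h]
  -- pass to `ℂ`: `|w|² = w · w̄`
  apply Complex.ofReal_injective
  have hn : ∀ w : ℂ, ((‖w‖ : ℝ) : ℂ) ^ 2 = w * star w := fun w => by
    rw [← starRingEnd_apply, Complex.mul_conj, Complex.normSq_eq_norm_sq, Complex.ofReal_pow]
  push_cast
  simp only [hn, pauliCoeff_zString, star_sum, star_mul, star_zSign, Finset.sum_mul_sum]
  -- `Σ_z Σ_x Σ_y χ_z(x) B_xx (B̄_yy χ_z(y)) = Σ_x Σ_y B_xx B̄_yy Σ_z χ_z(x) χ_z(y)`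
  calc ∑ z : ι → Bool, ∑ x, ∑ y, EntropyCeiling.zSign z x * B x x *
          (star (B y y) * EntropyCeiling.zSign z y)
      = ∑ x : ι → Bool, ∑ y, B x x * star (B y y) *
          ∑ z, EntropyCeiling.zSign z x * EntropyCeiling.zSign z y := by
        rw [Finset.sum_comm]
        refine Finset.sum_congr rfl fun x _ => ?_
        rw [Finset.sum_comm]
        refine Finset.sum_congr rfl fun y _ => ?_
        rw [Finset.mul_sum]
        exact Finset.sum_congr rfl fun z _ => by ring
    _ = ∑ x : ι → Bool, (2 : ℂ) ^ Fintype.card ι * (B x x * star (B x x)) := by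
        simp only [EntropyCeiling.sum_zSign_mul_zSign, mul_ite, mul_zero]
        refine Finset.sum_congr rfl fun x _ => ?_
        rw [Finset.sum_ite_eq Finset.univ x, if_pos (Finset.mem_univ x), mul_comm]
    _ = _ := by rw [Finset.mul_sum]

/-- **THE ONE-LAYER DIAGONAL FORM (S0).** Behind ONE clean unitary read-out layer `U` (any read-out bit `x₀`), the transmissivity of the sector `P` is
the mean squared diagonal of the Heisenberg picture of `σ_P` in the read-out basis: `π_U(P) = 2⁻ⁿ · Σ_x |(U σ_P U†)_{xx}|²` (`sectorTrans_head` +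
`sectorTrans_noLayers` + `transKer_eq` BY NAME, then Parseval over `{I,Z}ⁿ`). [cite: AharonovEtAl2023, Definition 5 and Lemma 5 (only {I,Z}ⁿ is read);
FeffermanEtAl2023, §10 Remark 20] -/
theorem sectorTrans_one_layer (U : Matrix (ι → Bool) (ι → Bool) ℂ) (x₀ : ι → Bool) (P : ι → Pauli) :
    sectorTrans 0 (fun _ : Fin 1 => U) x₀ P =
      ((2 : ℝ) ^ Fintype.card ι)⁻¹ * ∑ x, ‖(U * pauliString P * Uᴴ) x x‖ ^ 2 := by
  have h2 : (2 : ℝ) ^ Fintype.card ι ≠ 0 := by positivity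
  rw [sectorTrans_head]
  have htail : ∀ Q : ι → Pauli, sectorTrans 0 (Fin.tail fun _ : Fin 1 => U) x₀ Q =
      if (∀ i, Q i = Pauli.I ∨ Q i = Pauli.Z) then 1 else 0 := by
    intro Q
    rw [sectorTrans_noLayers, sub_zero, one_pow, one_pow]
  simp only [htail, mul_ite, mul_one, mul_zero]
  rw [← Finset.sum_filter]
  simp only [transKer_eq, sub_zero, one_pow, one_mul]
  rw [← Finset.sum_div, sum_ZType_norm_pauliCoeff_sq]
  field_simp

/-! ## §4 The law: pinching ceiling, Singer bound, isotropy at equality -/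

/-- **PAULI-REGULAR UNITARY OF PERIOD `m`** (the new object): `V` is unitary, `V^m` is central, and every power `V^k`, `0 < k < m`, moves every
non-identity string to an orthogonal one (`Tr((V^k)† σ_P V^k σ_P) = 0`). For `m = 2ⁿ + 1` these are the Singer-cycle (MUB-cycling) Cliffords. [cite:
BandyopadhyayEtAl2002, Lemma 3.1 and Theorem 3.2 (2ⁿ+1 disjoint commuting classes ↔ a complete set of MUBs); KlappeneckerRoetteler2005, §1] -/
structure IsPauliRegular (V : Matrix (ι → Bool) (ι → Bool) ℂ) (m : ℕ) : Prop where
  unitary : V ∈ Matrix.unitaryGroup (ι → Bool) ℂ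
  central : ∃ c : ℂ, V ^ m = c • (1 : Matrix (ι → Bool) (ι → Bool) ℂ)
  moves : ∀ P : ι → Pauli, P ≠ (fun _ => Pauli.I) → ∀ k, 0 < k → k < m →
    ((V ^ k)ᴴ * pauliString P * V ^ k * pauliString P).trace = 0

/-- Powers of a diagonalised matrix: `V = U† D U`, `U U† = 1` ⇒ `V^k = U† D^k U`. [folklore] -/
private theorem pow_eq_conj_diagonal_pow {V U : Matrix (ι → Bool) (ι → Bool) ℂ} {lam : (ι → Bool) → ℂ}
    (hUU : U * Uᴴ = 1) (hV : V = Uᴴ * Matrix.diagonal lam * U) (k : ℕ) :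
    V ^ k = Uᴴ * Matrix.diagonal (lam ^ k) * U := by
  induction k with
  | zero =>
    rw [pow_zero, pow_zero, show Matrix.diagonal (1 : (ι → Bool) → ℂ) = 1 from Matrix.diagonal_one, Matrix.mul_one]
    exact (mul_eq_one_comm.mp hUU).symm
  | succ k ih =>
    rw [pow_succ, ih, hV]
    calc Uᴴ * Matrix.diagonal (lam ^ k) * U * (Uᴴ * Matrix.diagonal lam * U)
        = Uᴴ * Matrix.diagonal (lam ^ k) * (U * Uᴴ) * Matrix.diagonal lam * U := by
          simp only [Matrix.mul_assoc]
      _ = Uᴴ * Matrix.diagonal (lam ^ (k + 1)) * U := by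
          rw [hUU, Matrix.mul_one, Matrix.mul_assoc Uᴴ, Matrix.diagonal_mul_diagonal, pow_succ]
          rfl

/-- `Tr(MN) = Σ_{x,y} M_{xy} N_{yx}`. [folklore] -/
private theorem trace_mul_eq_sum {n : Type*} [Fintype n] (M N : Matrix n n ℂ) :
    (M * N).trace = ∑ x, ∑ y, M x y * N y x := by
  simp only [Matrix.trace, Matrix.diag_apply, Matrix.mul_apply]

/-- Cyclicity: `Tr(U†XU·S·U†YU·S) = Tr(X·(USU†)·Y·(USU†))`. [folklore] -/
private theorem trace_cycle_conj {n : Type*} [Fintype n] (U X Y S : Matrix n n ℂ) :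
    (Uᴴ * X * U * S * (Uᴴ * Y * U) * S).trace = (X * (U * S * Uᴴ) * Y * (U * S * Uᴴ)).trace := by
  rw [show Uᴴ * X * U * S * (Uᴴ * Y * U) * S = Uᴴ * (X * U * S * Uᴴ * Y * U * S) by
      simp only [Matrix.mul_assoc], Matrix.trace_mul_comm]
  simp only [Matrix.mul_assoc]

/-- The cyclic trace in the eigenbasis: `Tr((V^k)† σ_P V^k σ_P) = Σ_{x,y} |B_{xy}|² (λ̄_x λ_y)^k`, `B = U σ_P U†` Hermitian. [cite: NielsenChuang2010,
§11.3.3 (pinching in an eigenbasis)] -/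
theorem trace_conj_pow_eq_sum {V U : Matrix (ι → Bool) (ι → Bool) ℂ} {lam : (ι → Bool) → ℂ}
    (hUU : U * Uᴴ = 1) (hV : V = Uᴴ * Matrix.diagonal lam * U) (P : ι → Pauli) (k : ℕ) :
    ((V ^ k)ᴴ * pauliString P * V ^ k * pauliString P).trace =
      ∑ x, ∑ y, (((‖(U * pauliString P * Uᴴ) x y‖ ^ 2 : ℝ)) : ℂ) * (star (lam x) * lam y) ^ k := by
  set B := U * pauliString P * Uᴴ with hB
  have h : Bᴴ = B := by
    rw [hB, Matrix.conjTranspose_mul, Matrix.conjTranspose_mul, Matrix.conjTranspose_conjTranspose,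
      conjTranspose_pauliString, ← Matrix.mul_assoc]
  have hBH : ∀ x y, B y x = star (B x y) := fun x y => by
    have hxy := congrFun (congrFun h x) y; rw [Matrix.conjTranspose_apply] at hxy; rw [← hxy, star_star]
  have hn : ∀ w : ℂ, (((‖w‖ ^ 2 : ℝ)) : ℂ) = w * star w := fun w => by
    rw [← starRingEnd_apply, Complex.mul_conj, Complex.normSq_eq_norm_sq]
  rw [pow_eq_conj_diagonal_pow hUU hV k, Matrix.conjTranspose_mul, Matrix.conjTranspose_mul,
    Matrix.conjTranspose_conjTranspose, Matrix.diagonal_conjTranspose,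
    show Uᴴ * (Matrix.diagonal (star (lam ^ k)) * U) = Uᴴ * Matrix.diagonal (star (lam ^ k)) * U from
      (Matrix.mul_assoc _ _ _).symm,
    trace_cycle_conj, ← hB, trace_mul_eq_sum]
  refine Finset.sum_congr rfl fun x _ => Finset.sum_congr rfl fun y _ => ?_
  have hE : (Matrix.diagonal (star (lam ^ k)) * B * Matrix.diagonal (lam ^ k)) x y =
      star (lam x) ^ k * B x y * lam y ^ k := by
    simp only [Matrix.mul_diagonal, Matrix.diagonal_mul, Pi.star_apply, Pi.pow_apply, star_pow]
  rw [hE, hBH x y, hn, mul_pow]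
  ring

/-- **THE PINCHING CEILING (S2).** If the unitary layer `U` diagonalises a unitary `V` (`V = U† diag(λ) U`) whose powers `V^k`, `0 < k < m`, move the
sector `P` to orthogonal strings and whose `m`-th power is central, then the one-layer clean read-out behind `U` transmits `P` with `π_U(P) ≤ 1/m`
(cyclic sum `= 2ⁿ` by orthogonality, `≥ m·Σ_x |B_xx|²` in the eigenbasis since `λ̄_x λ_y` is an `m`-th root of unity). [cite: AharonovEtAl2023,
Definition 5; NielsenChuang2010, §11.3.3 Theorem 11.9; BandyopadhyayEtAl2002, Theorem 3.2] -/
theorem sectorTrans_le_inv_of_moves {V U : Matrix (ι → Bool) (ι → Bool) ℂ} {lam : (ι → Bool) → ℂ}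
    (hU : U ∈ Matrix.unitaryGroup (ι → Bool) ℂ) (hVu : V ∈ Matrix.unitaryGroup (ι → Bool) ℂ)
    (hV : V = Uᴴ * Matrix.diagonal lam * U) {m : ℕ} (hm : 0 < m) {c : ℂ}
    (hVm : V ^ m = c • (1 : Matrix (ι → Bool) (ι → Bool) ℂ)) {P : ι → Pauli}
    (hmoves : ∀ k, 0 < k → k < m → ((V ^ k)ᴴ * pauliString P * V ^ k * pauliString P).trace = 0)
    (x₀ : ι → Bool) :
    sectorTrans 0 (fun _ : Fin 1 => U) x₀ P ≤ 1 / m := by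
  classical
  have hUU : U * Uᴴ = 1 := mul_ct_of_mem hU
  have hU'U : Uᴴ * U = 1 := ct_mul_of_mem hU
  have hVV : Vᴴ * V = 1 := ct_mul_of_mem hVu
  have h2 : (0 : ℝ) < (2 : ℝ) ^ Fintype.card ι := by positivity
  have hm' : (0 : ℝ) < m := by exact_mod_cast hm
  set B := U * pauliString P * Uᴴ with hB
  -- (F1) `|λ_x| = 1`: `D† D = U V† V U† = 1`
  have hD : Matrix.diagonal lam = U * V * Uᴴ := by
    rw [hV]
    calc Matrix.diagonal lam = (U * Uᴴ) * Matrix.diagonal lam * (U * Uᴴ) := by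
          rw [hUU, Matrix.one_mul, Matrix.mul_one]
      _ = U * (Uᴴ * Matrix.diagonal lam * U) * Uᴴ := by simp only [Matrix.mul_assoc]
  have hF1 : ∀ x, star (lam x) * lam x = 1 := by
    intro x
    have h : (Matrix.diagonal lam)ᴴ * Matrix.diagonal lam = 1 := by
      rw [hD, Matrix.conjTranspose_mul, Matrix.conjTranspose_mul, Matrix.conjTranspose_conjTranspose]
      calc U * (Vᴴ * Uᴴ) * (U * V * Uᴴ) = U * Vᴴ * (Uᴴ * U) * V * Uᴴ := by simp only [Matrix.mul_assoc]
        _ = 1 := by rw [hU'U, Matrix.mul_one, Matrix.mul_assoc U, hVV, Matrix.mul_one, hUU]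
    rw [Matrix.diagonal_conjTranspose, Matrix.diagonal_mul_diagonal] at h
    have hx := congrFun (congrFun h x) x
    rwa [Matrix.diagonal_apply_eq, Matrix.one_apply_eq, Pi.star_apply] at hx
  -- (F2) `λ_x^m = c`
  have hF2 : ∀ x, lam x ^ m = c := by
    intro x
    have h : Matrix.diagonal (lam ^ m) = c • (1 : Matrix (ι → Bool) (ι → Bool) ℂ) := by
      have hp := pow_eq_conj_diagonal_pow hUU hV m; rw [hVm] at hp
      calc Matrix.diagonal (lam ^ m) = (U * Uᴴ) * Matrix.diagonal (lam ^ m) * (U * Uᴴ) := by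
            rw [hUU, Matrix.one_mul, Matrix.mul_one]
        _ = U * (Uᴴ * Matrix.diagonal (lam ^ m) * U) * Uᴴ := by simp only [Matrix.mul_assoc]
        _ = c • (1 : Matrix (ι → Bool) (ι → Bool) ℂ) := by
            rw [← hp, Matrix.mul_smul, Matrix.smul_mul, Matrix.mul_one, hUU]
    have hx := congrFun (congrFun h x) x
    rwa [Matrix.diagonal_apply_eq, Matrix.smul_apply, Matrix.one_apply_eq, smul_eq_mul, mul_one,
      Pi.pow_apply] at hx
  -- roots of unity: `(λ̄_x λ_y)^m = 1`
  have hc1 : star c * c = 1 := by rw [← hF2 fun _ => false, star_pow, ← mul_pow, hF1, one_pow]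
  have hωm : ∀ x y, (star (lam x) * lam y) ^ m = 1 := fun x y => by
    rw [mul_pow, ← star_pow]; simp only [hF2]; exact hc1
  -- the cyclic sums `Σ_{k<m} (λ̄_x λ_y)^k ∈ {0, m}`
  set w : (ι → Bool) → (ι → Bool) → ℝ := fun x y => if star (lam x) * lam y = 1 then (m : ℝ) else 0 with hw
  have hgeom : ∀ x y, ∑ k ∈ Finset.range m, (star (lam x) * lam y) ^ k = ((w x y : ℝ) : ℂ) := by
    intro x y; simp only [hw]; split_ifs with h1
    · rw [h1]; simp
    · rw [geom_sum_eq h1, hωm, sub_self, zero_div]; simp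
  have hw0 : ∀ x y, 0 ≤ w x y := fun x y => by simp only [hw]; split_ifs <;> positivity
  have hwxx : ∀ x, w x x = m := fun x => by simp only [hw]; rw [if_pos (hF1 x)]
  -- the cyclic sum two ways
  have hsumL : ∑ k ∈ Finset.range m, ((V ^ k)ᴴ * pauliString P * V ^ k * pauliString P).trace =
      (2 : ℂ) ^ Fintype.card ι := by
    obtain ⟨m', rfl⟩ := Nat.exists_eq_succ_of_ne_zero hm.ne'
    rw [Finset.sum_range_succ', Finset.sum_eq_zero fun k hk => hmoves (k + 1) k.succ_pos
      (Nat.succ_lt_succ (Finset.mem_range.mp hk)), zero_add, pow_zero, Matrix.conjTranspose_one, Matrix.one_mul,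
      Matrix.mul_one, pauliString_mul_self, Matrix.trace_one, Fintype.card_fun, Fintype.card_bool]
    simp only [Nat.cast_pow, Nat.cast_ofNat]
  have hsumR : ∑ k ∈ Finset.range m, ((V ^ k)ᴴ * pauliString P * V ^ k * pauliString P).trace =
      ((∑ x, ∑ y, ‖B x y‖ ^ 2 * w x y : ℝ) : ℂ) := by
    simp only [trace_conj_pow_eq_sum hUU hV P, ← hB]
    rw [Finset.sum_comm]; push_cast
    refine Finset.sum_congr rfl fun x _ => ?_
    rw [Finset.sum_comm]
    exact Finset.sum_congr rfl fun y _ => by rw [← Finset.mul_sum, hgeom]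
  have hkey : (2 : ℝ) ^ Fintype.card ι = ∑ x, ∑ y, ‖B x y‖ ^ 2 * w x y := by exact_mod_cast hsumL.symm.trans hsumR
  -- diagonal terms only: `m Σ_x |B_xx|² ≤ 2ⁿ`
  have hdiag : (∑ x, ‖B x x‖ ^ 2) * (m : ℝ) ≤ (2 : ℝ) ^ Fintype.card ι := by
    rw [hkey, Finset.sum_mul]
    refine Finset.sum_le_sum fun x _ => ?_
    rw [← hwxx x]
    exact Finset.single_le_sum (f := fun y => ‖B x y‖ ^ 2 * w x y)
      (fun y _ => mul_nonneg (sq_nonneg _) (hw0 x y)) (Finset.mem_univ x)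
  rw [sectorTrans_one_layer, ← hB, inv_mul_le_iff₀ h2, mul_one_div, le_div_iff₀ hm']
  exact hdiag

/-- `|𝒫ⁿ| = 4ⁿ = (2ⁿ)²` as a real number. [folklore] -/
private theorem card_strings_cast :
    ((Fintype.card (ι → Pauli) : ℕ) : ℝ) = ((2 : ℝ) ^ Fintype.card ι) ^ 2 := by
  rw [Fintype.card_fun, Pauli.card_univ, ← pow_mul, Nat.cast_pow, show (4 : ℕ) = 2 ^ 2 from rfl, Nat.cast_pow,
    ← pow_mul, mul_comm]
  norm_num

/-- **THE SINGER BOUND (S3).** If a unitary read-out layer `U` diagonalises a unitary `V` whose powers `V^k`, `0 < k < m`, move every non-identity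
string to an orthogonal one and whose `m`-th power is central, then `m ≤ 2ⁿ + 1` (`n ≥ 1`): the `4ⁿ − 1` ceilings `π_U(P) ≤ 1/m` must still carry
L-67's sum rule `Σ_P π_U(P) = 2ⁿ` (`sum_sectorTrans` BY NAME), i.e. `m(2ⁿ − 1) ≤ 4ⁿ − 1`. [cite: BandyopadhyayEtAl2002, Theorem 3.2 (at most 2ⁿ+1
commuting classes); WoottersFields1989; AharonovEtAl2023, Lemma 4] -/
theorem period_le_of_moves {V U : Matrix (ι → Bool) (ι → Bool) ℂ} {lam : (ι → Bool) → ℂ}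
    (hU : U ∈ Matrix.unitaryGroup (ι → Bool) ℂ) (hVu : V ∈ Matrix.unitaryGroup (ι → Bool) ℂ)
    (hV : V = Uᴴ * Matrix.diagonal lam * U) {m : ℕ} (hm : 0 < m) {c : ℂ}
    (hVm : V ^ m = c • (1 : Matrix (ι → Bool) (ι → Bool) ℂ))
    (hmoves : ∀ P : ι → Pauli, P ≠ (fun _ => Pauli.I) → ∀ k, 0 < k → k < m →
      ((V ^ k)ᴴ * pauliString P * V ^ k * pauliString P).trace = 0)
    (hι : 0 < Fintype.card ι) : m ≤ 2 ^ Fintype.card ι + 1 := by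
  classical
  have hm' : (0 : ℝ) < m := by exact_mod_cast hm
  have h1 : (1 : ℝ) < (2 : ℝ) ^ Fintype.card ι := one_lt_pow₀ (by norm_num) hι.ne'
  have hsum := sum_sectorTrans (fun _ : Fin 1 => U) (fun _ => hU) (fun _ => false)
  rw [← Finset.add_sum_erase _ _ (Finset.mem_univ (fun _ : ι => Pauli.I)),
    sectorTrans_const_I 0 (fun _ => hU) (fun _ => false)] at hsum
  have hle : ∑ P ∈ Finset.univ.erase (fun _ : ι => Pauli.I), sectorTrans 0 (fun _ : Fin 1 => U) (fun _ => false) P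
      ≤ ((Fintype.card (ι → Pauli) - 1 : ℕ) : ℝ) * (1 / m) := by
    calc _ ≤ ∑ P ∈ Finset.univ.erase (fun _ : ι => Pauli.I), (1 / (m : ℝ)) :=
          Finset.sum_le_sum fun P hP => sectorTrans_le_inv_of_moves hU hVu hV hm hVm
            (hmoves P (Finset.ne_of_mem_erase hP)) _
      _ = _ := by
          rw [Finset.sum_const, Finset.card_erase_of_mem (Finset.mem_univ _), Finset.card_univ, nsmul_eq_mul]
  rw [Nat.cast_sub Fintype.card_pos, card_strings_cast, Nat.cast_one, mul_one_div] at hle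
  have key : ((2 : ℝ) ^ Fintype.card ι - 1) * m ≤ ((2 : ℝ) ^ Fintype.card ι) ^ 2 - 1 := by
    rw [← le_div_iff₀ hm']
    linarith
  have hmr : (m : ℝ) ≤ 2 ^ Fintype.card ι + 1 :=
    le_of_mul_le_mul_left (a := (2 : ℝ) ^ Fintype.card ι - 1) (by nlinarith [key]) (by linarith)
  exact_mod_cast hmr

/-- **ISOTROPY AT THE SINGER VALUE (S4).** The eigenbasis read-out `U` of a Pauli-regular unitary of period `2ⁿ + 1` is ISOTROPIC: `π_U(P) = 1/(2ⁿ+1)`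
for every `P ≠ Iⁿ` — the ceilings `≤ 1/(2ⁿ+1)` on the `4ⁿ − 1` moved sectors and `π_U(Iⁿ) = 1` already exhaust L-67's sum rule `Σ_P π_U(P) = 2ⁿ`
(`sum_sectorTrans` BY NAME), so every ceiling is attained. This is the profile L-110 (C4) left open for `n ≥ 2`. [cite: AharonovEtAl2023, Definition 5
and Lemma 4; BandyopadhyayEtAl2002, Theorem 3.2; WoottersFields1989] -/
theorem sectorTrans_eq_of_pauliRegular {V U : Matrix (ι → Bool) (ι → Bool) ℂ} {lam : (ι → Bool) → ℂ}
    (hU : U ∈ Matrix.unitaryGroup (ι → Bool) ℂ) (hV : V = Uᴴ * Matrix.diagonal lam * U)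
    (hreg : IsPauliRegular V (2 ^ Fintype.card ι + 1)) (x₀ : ι → Bool) {P : ι → Pauli}
    (hP : P ≠ fun _ => Pauli.I) :
    sectorTrans 0 (fun _ : Fin 1 => U) x₀ P = 1 / (2 ^ Fintype.card ι + 1) := by
  classical
  obtain ⟨c, hc⟩ := hreg.central
  set g : (ι → Pauli) → ℝ := fun Q => if Q = (fun _ => Pauli.I) then 1 else 1 / (2 ^ Fintype.card ι + 1) with hg
  have hle : ∀ Q ∈ (Finset.univ : Finset (ι → Pauli)), sectorTrans 0 (fun _ : Fin 1 => U) x₀ Q ≤ g Q := by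
    intro Q _; simp only [hg]; split_ifs with hQ
    · rw [hQ, sectorTrans_const_I 0 (fun _ => hU) x₀]
    · have h := sectorTrans_le_inv_of_moves hU hreg.unitary hV (Nat.succ_pos _) hc (hreg.moves Q hQ) x₀
      push_cast at h; exact h
  have hsumf : ∑ Q, sectorTrans 0 (fun _ : Fin 1 => U) x₀ Q = (2 : ℝ) ^ Fintype.card ι :=
    sum_sectorTrans _ (fun _ => hU) x₀
  have hsumg : ∑ Q, g Q = (2 : ℝ) ^ Fintype.card ι := by
    rw [← Finset.add_sum_erase _ _ (Finset.mem_univ (fun _ : ι => Pauli.I))]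
    rw [Finset.sum_congr rfl fun Q hQ => show g Q = 1 / (2 ^ Fintype.card ι + 1) from
        if_neg (Finset.ne_of_mem_erase hQ), Finset.sum_const, Finset.card_erase_of_mem (Finset.mem_univ _),
      Finset.card_univ, nsmul_eq_mul, Nat.cast_sub Fintype.card_pos, card_strings_cast, Nat.cast_one,
      show g (fun _ => Pauli.I) = 1 from if_pos rfl]
    field_simp; ring
  rw [(Finset.sum_eq_sum_iff_of_le hle).mp (hsumf.trans hsumg.symm) P (Finset.mem_univ P), hg]
  exact if_neg hP

/-- **EXISTENCE OF AN ISOTROPIC CLEAN READ-OUT (S4∃).** A Pauli-regular unitary of period `2ⁿ + 1` yields a unitary read-out layer transmitting EVERY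
non-identity sector with `1/(2ⁿ+1)`: its eigenbasis, obtained from the tree's spectral theorem
`Literature.LinearAlgebra.Matrix.isStarNormal_iff_exists_unitaryGroup_conj_eq_diagonal` BY NAME (no eigenvector is written down). [cite:
HornJohnson2013, Thm. 2.5.3; BandyopadhyayEtAl2002, Theorem 3.2; AharonovEtAl2023, Definition 5] -/
theorem exists_isotropic_of_pauliRegular {V : Matrix (ι → Bool) (ι → Bool) ℂ}
    (hreg : IsPauliRegular V (2 ^ Fintype.card ι + 1)) :
    ∃ U ∈ Matrix.unitaryGroup (ι → Bool) ℂ, ∀ (x₀ : ι → Bool) (P : ι → Pauli), P ≠ (fun _ => Pauli.I) →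
      sectorTrans 0 (fun _ : Fin 1 => U) x₀ P = 1 / (2 ^ Fintype.card ι + 1) := by
  have hVV' : V * Vᴴ = 1 := mul_ct_of_mem hreg.unitary
  have hVV : Vᴴ * V = 1 := ct_mul_of_mem hreg.unitary
  have hnormal : IsStarNormal V :=
    (Literature.LinearAlgebra.Matrix.isStarNormal_iff_conjTranspose_mul V).mpr (by rw [hVV, hVV'])
  obtain ⟨W, hW, d, hd⟩ :=
    (Literature.LinearAlgebra.Matrix.isStarNormal_iff_exists_unitaryGroup_conj_eq_diagonal V).mp hnormal
  rw [Matrix.star_eq_conjTranspose] at hd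
  have hWW' : W * Wᴴ = 1 := mul_ct_of_mem hW
  have hWW : Wᴴ * W = 1 := ct_mul_of_mem hW
  have hU : Wᴴ ∈ Matrix.unitaryGroup (ι → Bool) ℂ := by
    rw [Matrix.mem_unitaryGroup_iff, Matrix.star_eq_conjTranspose, Matrix.conjTranspose_conjTranspose]
    exact hWW
  have hV : V = Wᴴᴴ * Matrix.diagonal d * Wᴴ := by
    rw [Matrix.conjTranspose_conjTranspose, ← hd]
    calc V = (W * Wᴴ) * V * (W * Wᴴ) := by rw [hWW', Matrix.one_mul, Matrix.mul_one]
      _ = W * (Wᴴ * V * W) * Wᴴ := by simp only [Matrix.mul_assoc]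
  exact ⟨Wᴴ, hU, fun x₀ P hP => sectorTrans_eq_of_pauliRegular hU hV hreg x₀ hP⟩

/-- **THE NEGATION, GENERAL REGISTER (N1).** Wherever a Pauli-regular unitary of period `2ⁿ + 1` exists, L-90's uniform read-out floor
`floor_of_zero_one` FAILS without its idle/full hypothesis `h01`: the ONE-member clean unitary family «its eigenbasis read-out» is uniform with `β =
1/(2ⁿ+1) ∉ {0,1}` and `|J| = 1 < 2ⁿ + 1`. [cite: AharonovEtAl2023, Definition 5 and Lemma 4; BandyopadhyayEtAl2002, Theorem 3.2] -/
theorem not_floor_of_pauliRegular {V : Matrix (ι → Bool) (ι → Bool) ℂ}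
    (hreg : IsPauliRegular V (2 ^ Fintype.card ι + 1)) :
    ¬ ∀ (J : Type) [Fintype J] [Nonempty J] (d : ℕ) (C : J → Fin d → Matrix (ι → Bool) (ι → Bool) ℂ),
      (∀ j t, C j t ∈ Matrix.unitaryGroup (ι → Bool) ℂ) → ∀ (x₀ : ι → Bool) (β : ℝ),
      (∀ P : ι → Pauli, P ≠ (fun _ => Pauli.I) → ∑ j, sectorTrans 0 (C j) x₀ P = β) →
      2 ^ Fintype.card ι + 1 ≤ Fintype.card J := by
  intro h
  obtain ⟨U, hU, hiso⟩ := exists_isotropic_of_pauliRegular hreg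
  have h1 := h Unit 1 (fun _ _ => U) (fun _ _ => hU) (fun _ => false) (1 / (2 ^ Fintype.card ι + 1))
    (fun P hP => by rw [Fintype.sum_unique]; exact hiso _ P hP)
  rw [Fintype.card_unit] at h1
  have h2 : 1 ≤ 2 ^ Fintype.card ι := Nat.one_le_two_pow; omega

/-! ## §5 The two-qubit inhabitant `V₅ = CZ·(K ⊗ H′)`: a Pauli-regular unitary of period `5 = 2² + 1` -/

/-- Strings on the two-site register `Bool` from a letter pair (site `false` carries the first letter). [folklore] -/
def pr (pq : Pauli × Pauli) : Bool → Pauli := fun i => cond i pq.2 pq.1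

/-- Every two-site string is a letter pair. [folklore] -/
private theorem pr_eta (S : Bool → Pauli) : pr (S false, S true) = S := by funext i; cases i <;> rfl

/-- Distinct letter pairs give distinct strings. [folklore] -/
private theorem pr_injective : Function.Injective pr := by
  rintro ⟨p, q⟩ ⟨p', q'⟩ h
  have h0 := congrFun h false; have h1 := congrFun h true
  simp only [pr, cond_false, cond_true] at h0 h1; rw [h0, h1]

/-- The sign `(−1)^b`. [folklore] -/
def sgn (b : Bool) : ℂ := if b then -1 else 1

/-- Signs multiply by `xor`. [folklore] -/
private theorem sgn_mul_sgn (a b : Bool) : sgn a * sgn b = sgn (xor a b) := by cases a <;> cases b <;> simp [sgn]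

/-- `H′ = (1+i)(σ_X + σ_Z)/2` (`false = |0⟩`): the single-qubit Clifford with `H′† X H′ = Z`, `H′† Z H′ = X`, `H′† Y H′ = −Y`. [cite:
NielsenChuang2010, §10.5.2 Theorem 10.6 (Clifford normaliser of the Pauli group); folklore] -/
noncomputable def hMat : Matrix Bool Bool ℂ :=
  Matrix.of fun a b => if a && b then -(1 + Complex.I) / 2 else (1 + Complex.I) / 2

/-- The axis relabelling `X ↔ Z`, `Y ↦ Y` of `H′`, and its sign (`Y ↦ −Y`). [folklore] -/
def hAct : Pauli → Pauli
  | Pauli.I => Pauli.I | Pauli.X => Pauli.Z | Pauli.Y => Pauli.Y | Pauli.Z => Pauli.X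

/-- The sign of `H′` on the letters (`−` exactly on `Y`). [folklore] -/
def hNeg : Pauli → Bool
  | Pauli.Y => true | _ => false

/-- `H′` is unitary. [cite: NielsenChuang2010, §10.5.2] -/
theorem hMat_unitary : hMatᴴ * hMat = 1 := by
  ext a b
  simp only [Pauli.mul_apply_bool, Matrix.conjTranspose_apply, hMat, Matrix.of_apply, Matrix.one_apply]
  cases a <;> cases b <;> simp [Complex.ext_iff] <;> norm_num

/-- The one-qubit conjugation table of `H′`: `H′† σ_q H′ = ± σ_{hAct q}`. [cite: NielsenChuang2010, §10.5.2] -/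
theorem hMat_conj_mat (q : Pauli) : hMatᴴ * q.mat * hMat = sgn (hNeg q) • (hAct q).mat := by
  ext a b
  simp only [Pauli.mul_apply_bool, Matrix.conjTranspose_apply, hMat, Matrix.of_apply, Matrix.smul_apply, smul_eq_mul]
  cases q <;> cases a <;> cases b <;> simp [hAct, hNeg, sgn, Complex.ext_iff] <;> norm_num

/-- The controlled-Z gate `diag((−1)^{x₀ x₁})` on two qubits. [cite: NielsenChuang2010, §4.3 (controlled-Z)] -/
def czMat : Matrix (Bool → Bool) (Bool → Bool) ℂ := Matrix.diagonal fun x => if x false && x true then -1 else 1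

/-- The CZ action on letter pairs (`X_i ↦ X_i Z_{i'}`, `Z_i` fixed) and its sign (`−` exactly on `XY`, `YX`). [cite: NielsenChuang2010, §10.5.2
(conjugation of Paulis by CZ/CNOT)] -/
def czAct : Pauli × Pauli → Pauli × Pauli
  | (Pauli.X, Pauli.I) => (Pauli.X, Pauli.Z) | (Pauli.X, Pauli.Z) => (Pauli.X, Pauli.I) | (Pauli.Y, Pauli.I) => (Pauli.Y, Pauli.Z)
  | (Pauli.Y, Pauli.Z) => (Pauli.Y, Pauli.I) | (Pauli.I, Pauli.X) => (Pauli.Z, Pauli.X) | (Pauli.Z, Pauli.X) => (Pauli.I, Pauli.X)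
  | (Pauli.I, Pauli.Y) => (Pauli.Z, Pauli.Y) | (Pauli.Z, Pauli.Y) => (Pauli.I, Pauli.Y) | (Pauli.X, Pauli.X) => (Pauli.Y, Pauli.Y)
  | (Pauli.X, Pauli.Y) => (Pauli.Y, Pauli.X) | (Pauli.Y, Pauli.X) => (Pauli.X, Pauli.Y) | (Pauli.Y, Pauli.Y) => (Pauli.X, Pauli.X)
  | pq => pq

/-- The sign of the CZ table (`−` exactly on `XY`, `YX`). [cite: NielsenChuang2010, §10.5.2] -/
def czNeg : Pauli × Pauli → Bool
  | (Pauli.X, Pauli.Y) => true | (Pauli.Y, Pauli.X) => true | _ => false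

/-- CZ is Hermitian. [cite: NielsenChuang2010, §4.3] -/
theorem czMat_conjTranspose : czMatᴴ = czMat := by
  rw [czMat, Matrix.diagonal_conjTranspose]
  exact congrArg Matrix.diagonal (funext fun x => by simp only [Pi.star_apply]; split_ifs <;> simp)

/-- CZ is an involution. [cite: NielsenChuang2010, §4.3] -/
theorem czMat_mul_self : czMat * czMat = 1 := by
  rw [czMat, Matrix.diagonal_mul_diagonal, ← Matrix.diagonal_one]
  exact congrArg Matrix.diagonal (funext fun x => by split_ifs <;> norm_num)

/-- The two-qubit conjugation table of CZ: `CZ σ_{pq} CZ = ± σ_{czAct pq}`. [cite: NielsenChuang2010, §10.5.2] -/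
theorem czMat_conj (p q : Pauli) :
    czMat * pauliString (pr (p, q)) * czMat = sgn (czNeg (p, q)) • pauliString (pr (czAct (p, q))) := by
  ext x y
  simp only [czMat, Matrix.mul_diagonal, Matrix.diagonal_mul, pauliString_eq, tensorAll_apply, Fintype.prod_bool,
    Matrix.smul_apply, smul_eq_mul]
  generalize x false = x₀, x true = x₁, y false = y₀, y true = y₁
  cases p <;> cases q <;> cases x₀ <;> cases x₁ <;> cases y₀ <;> cases y₁ <;>
    simp [pr, czAct, czNeg, sgn]

/-- The local factors: site `false` the tree's axis-cycler `K = LocalScrambling.cycMat`, site `true` `H′`. [folklore] -/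
noncomputable def kh (i : Bool) : Matrix Bool Bool ℂ := cond i hMat LocalScrambling.cycMat

/-- The local layer `K ⊗ H′` (`tensorAll` BY NAME). [folklore] -/
noncomputable def locLayer : Matrix (Bool → Bool) (Bool → Bool) ℂ := tensorAll kh

/-- `K ⊗ H′` is unitary (`cycMat_unitary` BY NAME). [cite: NielsenChuang2010, §10.5.2] -/
theorem locLayer_unitary : locLayerᴴ * locLayer = 1 := by
  rw [locLayer, conjTranspose_tensorAll, tensorAll_mul, ← tensorAll_one]
  exact congrArg tensorAll (funext fun i => by cases i; exacts [LocalScrambling.cycMat_unitary, hMat_unitary])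

/-- The local layer's table: `(K ⊗ H′)† σ_{pq} (K ⊗ H′) = ± σ_{(rot p, hAct q)}` (`cycMat_conj_mat` BY NAME). [cite: KempeEtAl2010, §2
Observation 4] -/
theorem locLayer_conj (pq : Pauli × Pauli) :
    locLayerᴴ * pauliString (pr pq) * locLayer =
      sgn (hNeg pq.2) • pauliString (pr (LocalScrambling.rot pq.1, hAct pq.2)) := by
  obtain ⟨p, q⟩ := pq
  have hfun : (fun i => (kh i)ᴴ * (pr (p, q) i).mat * kh i) =
      fun i => (cond i (sgn (hNeg q)) 1 : ℂ) • (pr (LocalScrambling.rot p, hAct q) i).mat := by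
    funext i; cases i
    · simp only [kh, pr, cond_false]; rw [LocalScrambling.cycMat_conj_mat, one_smul]
    · simp only [kh, pr, cond_true]; exact hMat_conj_mat q
  calc locLayerᴴ * pauliString (pr (p, q)) * locLayer
      = tensorAll (fun i => (cond i (sgn (hNeg q)) 1 : ℂ) • (pr (LocalScrambling.rot p, hAct q) i).mat) := by
        rw [locLayer, pauliString_eq, conjTranspose_tensorAll, tensorAll_mul, tensorAll_mul, hfun]
    _ = sgn (hNeg q) • pauliString (pr (LocalScrambling.rot p, hAct q)) := by
        rw [tensorAll_smul, pauliString_eq, Fintype.prod_bool, cond_true, cond_false, mul_one]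

/-- **THE INHABITANT** `V₅ := CZ · (K ⊗ H′)` (a two-qubit Clifford). [cite: BandyopadhyayEtAl2002, §4 (d = 4); NielsenChuang2010, §10.5.2] -/
noncomputable def V5 : Matrix (Bool → Bool) (Bool → Bool) ℂ := czMat * locLayer

/-- One conjugation step of `V₅` on letter pairs (`V₅† σ_a V₅ = ± σ_{g₂ a}`: CZ first, then `K ⊗ H′`). [cite: KempeEtAl2010, §2 Observation 4] -/
def g2 (pq : Pauli × Pauli) : Pauli × Pauli :=
  (LocalScrambling.rot (czAct pq).1, hAct (czAct pq).2)

/-- The sign of that step. [cite: KempeEtAl2010, §2 Observation 4] -/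
def neg2 (pq : Pauli × Pauli) : Bool := xor (czNeg pq) (hNeg (czAct pq).2)

/-- `V₅` is unitary. [cite: NielsenChuang2010, §4.3 and §10.5.2] -/
theorem V5_mem_unitaryGroup : V5 ∈ Matrix.unitaryGroup (Bool → Bool) ℂ := by
  rw [Matrix.mem_unitaryGroup_iff', Matrix.star_eq_conjTranspose, V5, Matrix.conjTranspose_mul, czMat_conjTranspose,
    Matrix.mul_assoc, ← Matrix.mul_assoc czMat, czMat_mul_self, Matrix.one_mul, locLayer_unitary]

/-- The conjugation table of `V₅` on letter pairs. [cite: NielsenChuang2010, §10.5.2] -/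
theorem V5_conj (p q : Pauli) :
    V5ᴴ * pauliString (pr (p, q)) * V5 = sgn (neg2 (p, q)) • pauliString (pr (g2 (p, q))) := by
  rw [V5, Matrix.conjTranspose_mul, czMat_conjTranspose]
  calc locLayerᴴ * czMat * pauliString (pr (p, q)) * (czMat * locLayer)
      = locLayerᴴ * (czMat * pauliString (pr (p, q)) * czMat) * locLayer := by simp only [Matrix.mul_assoc]
    _ = sgn (czNeg (p, q)) • (locLayerᴴ * pauliString (pr (czAct (p, q))) * locLayer) := by
        rw [czMat_conj, Matrix.mul_smul, Matrix.smul_mul]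
    _ = sgn (neg2 (p, q)) • pauliString (pr (g2 (p, q))) := by
        rw [locLayer_conj, smul_smul, sgn_mul_sgn]
        rfl

/-- The step on strings: `g₅ a = g₂ (a₀, a₁)`. [folklore] -/
def g5 (a : Bool → Pauli) : Bool → Pauli := pr (g2 (a false, a true))

/-- Its phase `φ₅ a = ±1`. [folklore] -/
def phi5 (a : Bool → Pauli) : ℂ := sgn (neg2 (a false, a true))

/-- The conjugation table of `V₅` on strings, in the shape of `conj_pow_of_table`. [cite: KempeEtAl2010, §2 Observation 4] -/
theorem V5_table (a : Bool → Pauli) : V5ᴴ * pauliString a * V5 = phi5 a • pauliString (g5 a) := by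
  have h := V5_conj (a false) (a true); rwa [pr_eta] at h

/-- `g₅` on letter pairs. [folklore] -/
private theorem g5_pr (pq : Pauli × Pauli) : g5 (pr pq) = pr (g2 pq) := rfl

/-- `φ₅` on letter pairs. [folklore] -/
private theorem phi5_pr (pq : Pauli × Pauli) : phi5 (pr pq) = sgn (neg2 pq) := rfl

/-- Iterates of `g₅` on letter pairs. [folklore] -/
private theorem iterate_g5 (k : ℕ) (pq : Pauli × Pauli) : g5^[k] (pr pq) = pr (g2^[k] pq) := by
  induction k with
  | zero => rfl
  | succ k ih => rw [Function.iterate_succ_apply', ih, g5_pr, ← Function.iterate_succ_apply' g2]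

/-- ORBIT FACT 1 (kernel `decide` on the 16 letter pairs): the Pauli action of `V₅` has order `5 = 2² + 1`. [cite: BandyopadhyayEtAl2002, Theorem 3.2
and §4 (d = 4); WoottersFields1989] -/
theorem g2_iterate_five : ∀ pq : Pauli × Pauli, g2^[5] pq = pq := by decide

/-- ORBIT FACT 2 (kernel `decide`): `V₅, V₅², V₅³, V₅⁴` move EVERY non-identity string. [cite: BandyopadhyayEtAl2002, Theorem 3.2 and §4] -/
theorem g2_iterate_ne : ∀ pq : Pauli × Pauli, pq ≠ (Pauli.I, Pauli.I) → ∀ k < 5, 0 < k → g2^[k] pq ≠ pq := by decide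

/-- ORBIT FACT 3 (kernel `decide`): the signs along every 5-cycle multiply to `+1`. [cite: KlappeneckerRoetteler2005, §1 and Theorem 4] -/
theorem neg2_cycle : ∀ pq : Pauli × Pauli,
    xor (xor (xor (xor (neg2 (g2^[0] pq)) (neg2 (g2^[1] pq))) (neg2 (g2^[2] pq))) (neg2 (g2^[3] pq)))
      (neg2 (g2^[4] pq)) = false := by decide

/-- **`V₅` IS PAULI-REGULAR OF PERIOD 5 = 2² + 1.** Unitary; `V₅⁵` central by Schur-for-the-Pauli-group (the table returns after five steps with sign
`+`); every non-identity string moved to an orthogonal one by `V₅…V₅⁴`. [cite: BandyopadhyayEtAl2002, Theorem 3.2 and §4 (d = 4);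
KlappeneckerRoetteler2005, §1; NielsenChuang2010, §10.5.2] -/
theorem isPauliRegular_V5 : IsPauliRegular V5 5 where
  unitary := V5_mem_unitaryGroup
  central := by
    refine ⟨_, pow_eq_smul_one_of_table V5_table V5_mem_unitaryGroup (fun a => ?_) (fun a => ?_)⟩
    · rw [← pr_eta a, iterate_g5, g2_iterate_five]
    · rw [← pr_eta a]
      simp only [Finset.prod_range_succ, Finset.prod_range_zero, iterate_g5, phi5_pr, one_mul, sgn_mul_sgn, neg2_cycle]; rfl
  moves := by
    intro P hP k hk0 hk5
    refine trace_conj_pow_eq_zero V5_table ?_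
    rw [← pr_eta P, iterate_g5]
    have hne : (P false, P true) ≠ (Pauli.I, Pauli.I) := fun h => hP (by
      rw [← pr_eta P, h]; funext i; cases i <;> rfl)
    exact fun h => g2_iterate_ne _ hne k hk5 hk0 (pr_injective h)

/-- The same, indexed by the register size `2 ^ |Bool| + 1 = 5`. [cite: BandyopadhyayEtAl2002, Theorem 3.2 and §4 (d = 4)] -/
theorem isPauliRegular_V5' : IsPauliRegular V5 (2 ^ Fintype.card Bool + 1) := by
  rw [Fintype.card_bool]; exact isPauliRegular_V5

/-- **AN ISOTROPIC CLEAN UNITARY READ-OUT EXISTS ON TWO QUBITS (N2)** — L-110's open C4 one register up: some `U ∈ U(4)` transmits every one of the 15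
non-identity sectors with exactly `1/5`. [cite: BandyopadhyayEtAl2002, §4; WoottersFields1989; AharonovEtAl2023, Definition 5] -/
theorem exists_isotropic_two :
    ∃ U ∈ Matrix.unitaryGroup (Bool → Bool) ℂ, ∀ (x₀ : Bool → Bool) (P : Bool → Pauli), P ≠ (fun _ => Pauli.I) →
      sectorTrans 0 (fun _ : Fin 1 => U) x₀ P = 1 / 5 := by
  obtain ⟨U, hU, h⟩ := exists_isotropic_of_pauliRegular isPauliRegular_V5'
  refine ⟨U, hU, fun x₀ P hP => ?_⟩
  rw [h x₀ P hP, Fintype.card_bool]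
  norm_num

/-- **THE NEGATION AT `n = 2` (N1′).** On two qubits the uniform read-out floor `|J| ≥ 2ⁿ + 1 = 5` of L-90 (`floor_of_zero_one`) fails without `h01`,
with the maximal deficit: ONE clean unitary member, uniform `β = 1/5`. [cite: AharonovEtAl2023, Definition 5 and Lemma 4; BandyopadhyayEtAl2002, §4]
-/
theorem not_floor_two :
    ¬ ∀ (J : Type) [Fintype J] [Nonempty J] (d : ℕ) (C : J → Fin d → Matrix (Bool → Bool) (Bool → Bool) ℂ),
      (∀ j t, C j t ∈ Matrix.unitaryGroup (Bool → Bool) ℂ) → ∀ (x₀ : Bool → Bool) (β : ℝ),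
      (∀ P : Bool → Pauli, P ≠ (fun _ => Pauli.I) → ∑ j, sectorTrans 0 (C j) x₀ P = β) →
      5 ≤ Fintype.card J := by
  simpa [Fintype.card_bool] using not_floor_of_pauliRegular isPauliRegular_V5'

end Literature.Computability.QuantumComplexity.PauliPath.DampingCleanSuffix.MemberCollision.UniformReadout.SelfDual.Singer
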